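import Summits.CriticalPhenomena.CardyFormulaZ2.Theorems.CardyRotToConfR2SymmetryUpgrade.Negative.SurgFatMarkovKernel
import Summits.CriticalPhenomena.CardyFormulaZ2.Theorems.CardyRotToConfR2SymmetryUpgradeSlitTrace
import Summits.CriticalPhenomena.CardyFormulaZ2.Theorems.CardyRotToConfR2SymmetryUpgradeMarkovTip
import Literature.Probability.RandomPlanarGeometry.ChordalKSCondition
import HarnessLib

/-!
# The surgery kernel agrees with `S`'s own kernel along `S`-curves of a non-firing domain
# (line `germ-label-transport`, crux `CardyRotToConfR2SymmetryUpgrade`, stmt-CriticalPhenomena-0698)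

Heart of the Markov property of the fat-germ one-shot surgery `Negative.fatSurgery S`: for an
admissible family `S` with a NORMALISED Markov extension `Q` (`Q D p = δ_{const b}` at pasts with
tip `b`), whose curves trace no straight segment and have Lebesgue-null range, and a Dobrushin
domain `D` that does NOT fire at `a = D.pt 0`, the candidate kernel `Negative.surgExt S Q D` of
the surgery agrees with `Q D` at the stopped past `stopAt F γ` of `S D`-almost every curve `γ`,
for every closed `F`. Case analysis on the configuration (remaining domain, tip, target):
Jordan configuration — the kernel is the surgery law of that domain, `Q` is the fresh law
(renewal, `kernel_eq_of_jordan_remaining`), and the domain does not fire by the firing-tip lemma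
`stub_fatSurgeryMarkovTip` (null range + generalized tip separation); slit configuration —
excluded: it pins a traced segment (`stub_slitTrace`); tip at the target — both are `δ_{const b}`;
otherwise the configuration is realised by `(D, stopAt F γ)` itself and the kernel is `Q` by the
`domain` clause.
-/

noncomputable section

open Set Filter Topology Metric MeasureTheory
open scoped unitInterval ENNReal

namespace Summit.CriticalPhenomena.CardyFormulaZ2.Theorems.CardyRotToConfR2SymmetryUpgrade

open Literature.Probability.RandomPlanarGeometry Literature.Probability.RandomPlanarGeometry.ChordalFamily
open Summit.CriticalPhenomena.CardyFormulaZ2.Theorems.CardyRotToConfR2SymmetryUpgrade.Negative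

namespace MarkovKernelAE

variable {S : ChordalFamily} {Q : DobrushinDomain → CurveClass ℂ → Measure (CurveClass ℂ)}

/-- **Pointwise form.** For a class `γ` from `a = D.pt 0` with trace in `closure D`, Lebesgue-null
trace and no non-degenerate collinear sub-arc, in a non-firing domain `D`: the surgery kernel at
the past `stopAt F γ` is `Q D (stopAt F γ)` (for `S` local with normalised Markov extension `Q`).
[folklore] -/
theorem surgExt_stopAt_eq (hS : S.IsLocal) (hQ : S.IsMarkovExtension Q)
    (hQn : ∀ (D : DobrushinDomain) (p : CurveClass ℂ), p.target = D.pt 1 →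
      Q D p = Measure.dirac (CurveClass.mk (Curve.const (D.pt 1))))
    {D : DobrushinDomain} (hD : ¬ Fires D.carrier (D.pt 0)) {F : Set ℂ} (hF : IsClosed F)
    {γ : CurveClass ℂ} (hsrc : γ.source = D.pt 0) (hran : γ.range ⊆ closure D.carrier)
    (hnull : volume γ.range = 0)
    (hseg : ∀ c : Curve ℂ, CurveClass.mk c = γ → ∀ s t : I, s < t →
      Collinear ℝ (c '' Icc s t) → (c '' Icc s t).Subsingleton) :
    surgExt S Q D (CurveClass.stopAt F γ) = Q D (CurveClass.stopAt F γ) := by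
  set p := CurveClass.stopAt F γ with hp
  have hpsrc : p.source = D.pt 0 := by rw [hp, CurveClass.source_stopAt, hsrc]
  have hpran : p.range ⊆ closure D.carrier := (CurveClass.range_stopAt_subset F γ).trans hran
  have hpnull : volume p.range = 0 := measure_mono_null (CurveClass.range_stopAt_subset F γ) hnull
  rw [surgExt]
  by_cases hJ : IsJordanConfig (remainingDomain D p) p.target (D.pt 1)
  · -- Jordan configuration: surgery law of `D₂` = `S D₂` (no fire at the tip) = `Q D p` (renewal)
    obtain ⟨D₂, hc, h0, h1⟩ := hJ
    rw [surgKernel_of_jordan hS hc h0 h1, kernel_eq_of_jordan_remaining hQ hc.symm h0.symm h1.symm]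
    have hnf : ¬ Fires D₂.carrier (D₂.pt 0) :=
      stub_fatSurgeryMarkovTip D D₂ p hD hpsrc hpran hpnull hc h0 h1
    exact fatSurgery_of_not_fires hnf
  by_cases hSl : IsSlitConfig (remainingDomain D p) p.target (D.pt 1)
  · -- slit configuration: impossible, it pins a traced segment
    exfalso
    obtain ⟨D₁, s, h₁, -, hs0, hs1, hz, hV⟩ := hSl
    obtain ⟨c, hcγ, s', t', hst, hcol, hns⟩ :=
      stub_slitTrace D D₁ F hF h₁ s hs0 hs1 γ hsrc (by rw [← hp, hV, hz]) (by rw [← hp, hz])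
    exact hns (hseg c hcγ s' t' hst hcol)
  by_cases hz : p.target = D.pt 1
  · rw [surgKernel_of_target hJ hSl hz, hQn D p hz]
  · exact surgKernel_of_realizable hQ hJ hSl hz rfl rfl rfl

/-- **Almost-sure form.** For `S` chordal and local with normalised Markov extension `Q`, whose
laws charge only classes with Lebesgue-null trace and no traced straight segment, and a non-firing
domain `D`: `S D`-a.s. the surgery kernel at `stopAt F γ` is `Q D (stopAt F γ)`. [folklore] -/
theorem ae_surgExt_stopAt_eq (hSc : S.IsChordal) (hS : S.IsLocal) (hQ : S.IsMarkovExtension Q)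
    (hQn : ∀ (D : DobrushinDomain) (p : CurveClass ℂ), p.target = D.pt 1 →
      Q D p = Measure.dirac (CurveClass.mk (Curve.const (D.pt 1))))
    (hseg : ∀ D : DobrushinDomain, ∀ᵐ γ ∂(S D), ∀ c : Curve ℂ, CurveClass.mk c = γ →
      ∀ s t : I, s < t → Collinear ℝ (c '' Icc s t) → (c '' Icc s t).Subsingleton)
    (hnull : ∀ D : DobrushinDomain, ∀ᵐ γ ∂(S D), volume γ.range = 0)
    {D : DobrushinDomain} (hD : ¬ Fires D.carrier (D.pt 0)) {F : Set ℂ} (hF : IsClosed F) :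
    ∀ᵐ γ ∂(S D), surgExt S Q D (CurveClass.stopAt F γ) = Q D (CurveClass.stopAt F γ) := by
  filter_upwards [(hSc D).2, hseg D, hnull D] with γ hγ hγseg hγnull
  exact surgExt_stopAt_eq hS hQ hQn hD hF hγ.1 hγ.2.2 hγnull hγseg

end MarkovKernelAE

open MarkovKernelAE in
/-- **Kernel agreement along `S`-curves of a non-firing domain** (helper of
`stub_fatSurgeryMarkovCore`): for an admissible family `S` with a normalised Markov extension `Q`,
no traced segment and null range, and a domain `D` not firing at `D.pt 0`, the surgery's candidate
kernel `Negative.surgExt S Q D` agrees with `Q D` at `stopAt F γ` for `S D`-a.e. `γ`, for every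
closed `F`. [folklore] -/
theorem stub_fatSurgeryMarkovKernelAE : ∀ (S : ChordalFamily) (Q : DobrushinDomain → CurveClass ℂ → MeasureTheory.Measure (CurveClass ℂ)), IsLocalMarkovChordalFamily S → S.IsMarkovExtension Q → (∀ (D : DobrushinDomain) (p : CurveClass ℂ), p.target = D.pt 1 → Q D p = MeasureTheory.Measure.dirac (CurveClass.mk (Curve.const (D.pt 1)))) → (∀ D : DobrushinDomain, ∀ᵐ γ ∂(S D), ∀ c : Curve ℂ, CurveClass.mk c = γ → ∀ s t : unitInterval, s < t → Collinear ℝ (c '' Set.Icc s t) → (c '' Set.Icc s t).Subsingleton) → (∀ D : DobrushinDomain, ∀ᵐ γ ∂(S D), MeasureTheory.volume γ.range = 0) → ∀ D : DobrushinDomain, ¬ Summit.CriticalPhenomena.CardyFormulaZ2.Theorems.CardyRotToConfR2SymmetryUpgrade.Negative.Fires D.carrier (D.pt 0) → ∀ F : Set ℂ, IsClosed F → ∀ᵐ γ ∂(S D), Summit.CriticalPhenomena.CardyFormulaZ2.Theorems.CardyRotToConfR2SymmetryUpgrade.Negative.surgExt S Q D (CurveClass.stopAt F γ) = Q D (CurveClass.stopAt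 F γ) :=
  fun _ _ hS hQ hQn hseg hnull _ hD _ hF => ae_surgExt_stopAt_eq hS.isChordal hS.isLocal hQ hQn hseg hnull hD hF

end Summit.CriticalPhenomena.CardyFormulaZ2.Theorems.CardyRotToConfR2SymmetryUpgrade

end
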